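import Literature.Probability.Percolation.SlabBoxCrossingProperty
import Literature.Probability.Percolation.SlabRSWTheorem314Closer
import Literature.Probability.Percolation.SlabRSWProp39b
import HarnessLib

/-!
# Newman–Tassion–Wu 2017, §3.7 — the box-crossing property from the two RSW conclusions
# `inf_n f(2n,n) > 0` (3.59) and `sup_n f(n,2n) < 1` (3.60)

Topic: `Literature/Probability/Percolation`. The last paragraph of the proof of NTW's Theorem 3.1
(arXiv:1512.09107 §3.7: "Eqs. (3.59) and (3.60) together with Items 1 and 2 of Proposition 3.9
conclude the proof"), for an ARBITRARY parameter `0 < p < 1` of the slab `S_k` (`k ≥ 1`):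

* `real_lr_long_ge` — from `f(2N,N) ≥ c₁` for all `N`: `f(rN, N) ≥ a_{r-2}` for every `r ≥ 2` and
  `N ≥ 4ρ₀+9`, where `a_0 = c₁`, `a_{i+1} = φ(a_i)`, `φ(x) = ((1-√(1-x))x)²/(K₁²K₂)` is the linear-regime
  function of Prop. 3.9 (1) (`prop39_item1`): a positive, non-increasing sequence;
* `le_one_sub_pow_three_of_g_le`, `real_lr_tall_le` — from `f(N,2N) ≤ 1 - c₂`:
  `f(N, (2^j+1)N) ≤ 1 - c₂^{3^j}` (Prop. 3.9 (2), `prop39_item2_step'`, read backwards);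
* **`boxCrossingProperty_of_rsw`** — `(∃ c₁>0, ∀ n ≥ 1, c₁ ≤ f_p(2n,n)) → (∃ c₂>0, ∀ n ≥ 1,
  f_p(n,2n) ≤ 1-c₂) → BoxCrossingProperty k p`.

With `SlabRSWTheorem314Closer.hardWay_of_f28_14` (Thm 3.14's closing step), Lemma 3.15, Case 1
(`SlabRSWLadder.case1_of_B1`) and Cor. 3.2 (`SlabBoxCrossingProperty*.lean`) this leaves, for
`NewmanTassionWu2017_thm31_holds`, exactly: Thm 3.14 Cases 2–3 (GL with `S ⊊ R`; Lemma 3.16) and the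
upper half (Lemma 3.11 / 3.13(i), Thm 3.17) — Layer 1b of the port.

## Sources

* C. M. Newman, V. Tassion, W. Wu, *Critical percolation and the minimal spanning tree in slabs*,
  Comm. Pure Appl. Math. 70 (2017) 2084–2120, arXiv:1512.09107: §3.7 (proof of Theorem 3.1),
  Proposition 3.9 [NewmanTassionWu2017].
-/

noncomputable section

namespace Literature.Probability.Percolation

open MeasureTheory LatticeModels SimpleGraph

namespace NTW17

variable {k : ℕ}

/-! ## §1 Long rectangles: iterating Proposition 3.9 (1) -/

/-- The linear-regime function `φ_K(x) = ((1 - √(1-x)) x)² / K` of Prop. 3.9 (1) is increasing on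
`[0,∞)`. [cite: NewmanTassionWu2017, §3.3 (Proposition 3.9 (1))] -/
theorem phi_mono {K x y : ℝ} (hK : 0 < K) (hx : 0 ≤ x) (hxy : x ≤ y) :
    ((1 - Real.sqrt (1 - x)) * x) ^ 2 / K ≤ ((1 - Real.sqrt (1 - y)) * y) ^ 2 / K := by
  have hsq : 1 - Real.sqrt (1 - x) ≤ 1 - Real.sqrt (1 - y) := by
    have := Real.sqrt_le_sqrt (show 1 - y ≤ 1 - x by linarith); linarith
  have hs0 : 0 ≤ 1 - Real.sqrt (1 - x) := by
    have h1 : Real.sqrt (1 - x) ≤ Real.sqrt 1 := Real.sqrt_le_sqrt (by linarith)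
    rw [Real.sqrt_one] at h1; linarith
  have hprod : (1 - Real.sqrt (1 - x)) * x ≤ (1 - Real.sqrt (1 - y)) * y :=
    mul_le_mul hsq hxy hx (hs0.trans hsq)
  exact div_le_div_of_nonneg_right (pow_le_pow_left₀ (mul_nonneg hs0 hx) hprod 2) hK.le

/-- `0 < φ_K(x) ≤ x` for `0 < x ≤ 1` and `K ≥ 1`. [cite: NewmanTassionWu2017, §3.3 (Proposition 3.9 (1))] -/
theorem phi_pos_le {K x : ℝ} (hK : 1 ≤ K) (hx : 0 < x) (hx1 : x ≤ 1) :
    0 < ((1 - Real.sqrt (1 - x)) * x) ^ 2 / K ∧ ((1 - Real.sqrt (1 - x)) * x) ^ 2 / K ≤ x := by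
  have hs1 : Real.sqrt (1 - x) < 1 := by
    have h1 : Real.sqrt (1 - x) < Real.sqrt 1 := Real.sqrt_lt_sqrt (by linarith) (by linarith)
    rwa [Real.sqrt_one] at h1
  have hs0 : 0 < 1 - Real.sqrt (1 - x) := by linarith
  have hsle : 1 - Real.sqrt (1 - x) ≤ 1 := by linarith [Real.sqrt_nonneg (1 - x)]
  refine ⟨by positivity, ?_⟩
  rw [div_le_iff₀ (by linarith)]
  have h1 : (1 - Real.sqrt (1 - x)) * x ≤ x := by nlinarith
  have h2 : ((1 - Real.sqrt (1 - x)) * x) ^ 2 ≤ x ^ 2 := pow_le_pow_left₀ (by positivity) h1 2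
  nlinarith

/-- **Long rectangles** (iterating Prop. 3.9 (1) in the linear regime): if `c₁ ≤ f_p(2N, N)` for
every `N ≥ 1` (`0 < c₁ ≤ 1`), there is a positive non-increasing sequence `a` (`a_0 = c₁`,
`a_{i+1} = φ(a_i)`) with `a_{r-2} ≤ f_p(rN, N)` for all `r ≥ 2` and `N ≥ 4ρ+9`.
[cite: NewmanTassionWu2017, §3.3 (Proposition 3.9 (1)) and §3.7] -/
theorem real_lr_long_ge (hk : 1 ≤ k) {ρ : ℕ} (hρ : 4 ≤ ρ) (p : unitInterval) (hp0 : 0 < (p : ℝ))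
    (hp1 : (p : ℝ) < 1) {c₁ : ℝ} (hc₁ : 0 < c₁) (hc₁' : c₁ ≤ 1)
    (h : ∀ N : ℕ, 1 ≤ N → c₁ ≤ (bondPercolation (slabGraph 3 k) p).real
      (slabConn k (boxR 0 (2 * N) 0 N) {z | z.1 = 0} {z | z.1 = 2 * N})) :
    ∃ a : ℕ → ℝ, (∀ i, 0 < a i) ∧ (∀ i, a i ≤ 1) ∧ (∀ i, a (i + 1) ≤ a i) ∧
      ∀ j N : ℕ, 4 * ρ + 9 ≤ N → a j ≤ (bondPercolation (slabGraph 3 k) p).real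
        (slabConn k (boxR 0 ((j + 2) * N) 0 N) {z | z.1 = 0} {z | z.1 = (j + 2) * N}) := by
  set P := bondPercolation (slabGraph 3 k) p with hP
  set K : ℝ := (1 + (2 / min (p : ℝ) (1 - p)) ^ (3 * ((5 * k + 4) * (2 * (6 * ρ + 4) + 1) ^ 2))) ^ 2 *
      (1 + (2 / min (p : ℝ) (1 - p)) ^ (3 * ((5 * k + 4) * (2 * (2 * (3 * ρ + 3)) + 1) ^ 2))) with hK
  have hK1 : 1 ≤ K := by
    have h1 : (1 : ℝ) ≤ 1 + (2 / min (p : ℝ) (1 - p)) ^ (3 * ((5 * k + 4) * (2 * (6 * ρ + 4) + 1) ^ 2)) :=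
      le_add_of_nonneg_right (by positivity)
    have h2 : (1 : ℝ) ≤ 1 + (2 / min (p : ℝ) (1 - p)) ^ (3 * ((5 * k + 4) * (2 * (2 * (3 * ρ + 3)) + 1) ^ 2)) :=
      le_add_of_nonneg_right (by positivity)
    rw [hK]; exact one_le_mul_of_one_le_of_one_le (one_le_pow₀ h1) h2
  have hKpos : 0 < K := lt_of_lt_of_le one_pos hK1
  clear_value K
  let φ : ℝ → ℝ := fun x => ((1 - Real.sqrt (1 - x)) * x) ^ 2 / K
  let a : ℕ → ℝ := fun i => φ^[i] c₁
  have ha_succ : ∀ i, a (i + 1) = φ (a i) := fun i => Function.iterate_succ_apply' φ i c₁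
  have ha01 : ∀ i, 0 < a i ∧ a i ≤ 1 := by
    intro i
    induction i with
    | zero => exact ⟨hc₁, hc₁'⟩
    | succ i ih =>
      rw [ha_succ]
      have := phi_pos_le hK1 ih.1 ih.2
      exact ⟨this.1, this.2.trans ih.2⟩
  refine ⟨a, fun i => (ha01 i).1, fun i => (ha01 i).2, fun i => ?_, fun j => ?_⟩
  · rw [ha_succ]; exact (phi_pos_le hK1 (ha01 i).1 (ha01 i).2).2
  · induction j with
    | zero =>
      intro N hN
      have := h N (by omega)
      show φ^[0] c₁ ≤ _
      rw [Function.iterate_zero_apply]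
      simpa using this
    | succ j ih =>
      intro N hN
      have hN0 : (0 : ℤ) ≤ N := by positivity
      have hρN : (4 : ℤ) * ρ + 9 ≤ N := by exact_mod_cast hN
      -- Prop. 3.9 (1) with `n = m = N`, index `j + 1`
      have hdiv : (N : ℤ) / 2 ≤ N := Int.ediv_le_self 2 hN0
      have hjN : (N : ℤ) ≤ ((j + 1 : ℕ) : ℤ) * N := by
        have : (1 : ℤ) * N ≤ ((j + 1 : ℕ) : ℤ) * N :=
          mul_le_mul_of_nonneg_right (by exact_mod_cast Nat.succ_le_succ (Nat.zero_le j)) hN0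
        simpa using this
      have hstep := prop39_item1 (k := k) hk hρ (n := N) (m := N) (h := N / 2) (j := j + 1) (by omega)
        (by omega) (by omega) (by omega) hN0 (by linarith) p hp0 hp1
      rw [← hK] at hstep
      have e1 : (N : ℤ) + ((j + 1 : ℕ) : ℤ) * N = ((j + 2 : ℕ) : ℤ) * N := by push_cast; ring
      have e2 : (N : ℤ) + (((j + 1 : ℕ) : ℤ) + 1) * N = ((j + 1 + 2 : ℕ) : ℤ) * N := by push_cast; ring
      rw [e1, e2] at hstep
      push_cast at hstep ⊢
      have ihN := ih N hN
      set F := P.real (slabConn k (boxR 0 ((j + 2) * (N : ℤ)) 0 N) {z : ℤ × ℤ | z.1 = 0} {z | z.1 = (j + 2) * (N : ℤ)})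
        with hF
      rw [ha_succ]
      calc φ (a j) ≤ φ F := phi_mono hKpos (ha01 j).1.le ihN
        _ ≤ _ := by
          show ((1 - Real.sqrt (1 - F)) * F) ^ 2 / K ≤ _
          rw [div_le_iff₀ hKpos]
          linarith [hstep]

/-! ## §2 Tall rectangles: Proposition 3.9 (2) read backwards -/

/-- If `g(y) = 1 - (1-y)^{1/3} ≤ 1 - c` with `0 ≤ c` and `y ≤ 1`, then `y ≤ 1 - c³`.
[cite: NewmanTassionWu2017, §3.3 (Proposition 3.9 (2))] -/
theorem le_one_sub_pow_three_of_g_le {y c : ℝ} (hy : y ≤ 1) (hc : 0 ≤ c)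
    (h : 1 - (1 - y) ^ ((3 : ℝ)⁻¹) ≤ 1 - c) : y ≤ 1 - c ^ 3 := by
  have h1 : c ≤ (1 - y) ^ ((3 : ℝ)⁻¹) := by linarith
  have h2 : c ^ 3 ≤ ((1 - y) ^ ((3 : ℝ)⁻¹)) ^ 3 := pow_le_pow_left₀ hc h1 3
  have h3 : ((1 - y) ^ ((3 : ℝ)⁻¹)) ^ (3 : ℕ) = 1 - y := by
    rw [← Real.rpow_natCast, ← Real.rpow_mul (by linarith)]
    norm_num
  rw [h3] at h2
  linarith

/-- **Tall rectangles**: if `f_p(N, 2N) ≤ 1 - c₂` (`0 ≤ c₂`), then `f_p(N, (2^j+1)N) ≤ 1 - c₂^{3^j}`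
for every `j`. [cite: NewmanTassionWu2017, §3.3 (Proposition 3.9 (2)) and §3.7] -/
theorem real_lr_tall_le {N : ℕ} {c₂ : ℝ} (hc₂ : 0 ≤ c₂) (p : unitInterval)
    (h : (bondPercolation (slabGraph 3 k) p).real
      (slabConn k (boxR 0 N 0 (2 * N)) {z | z.1 = 0} {z | z.1 = N}) ≤ 1 - c₂) (j : ℕ) :
    (bondPercolation (slabGraph 3 k) p).real
      (slabConn k (boxR 0 N 0 ((2 ^ j + 1) * N)) {z | z.1 = 0} {z | z.1 = N}) ≤ 1 - c₂ ^ (3 ^ j) := by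
  induction j with
  | zero => simpa [two_mul, add_mul] using h
  | succ j ih =>
    have hN0 : (0 : ℤ) ≤ N := by positivity
    have hm : (0 : ℤ) ≤ 2 ^ j * (N : ℤ) := by positivity
    have hstep := prop39_item2_step' (k := k) (n := N) (m := 2 ^ j * N) (m' := 2 ^ j * N) hm le_rfl hN0 p
    rw [show (N : ℤ) + 2 ^ j * N + 2 ^ j * N = (2 ^ (j + 1) + 1) * N by ring,
      show (N : ℤ) + 2 ^ j * N = (2 ^ j + 1) * N by ring] at hstep
    have h1 := le_one_sub_pow_three_of_g_le measureReal_le_one (by positivity : 0 ≤ c₂ ^ (3 ^ j))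
      (hstep.trans ih)
    rw [← pow_mul, ← pow_succ] at h1
    exact h1

/-! ## §3 The box-crossing property from (3.59) and (3.60) -/

/-- **NTW 2017, §3.7 — THE BOX-CROSSING PROPERTY FROM THE TWO RSW CONCLUSIONS.**  Slab `S_k`
(`k ≥ 1`), `0 < p < 1` (and a gluing radius `ρ₀ ≥ 4`).  If `inf_{n≥1} f_p(2n,n) > 0` ((3.59)) and
`sup_{n≥1} f_p(n,2n) < 1` ((3.60)), then the box-crossing property `BoxCrossingProperty k p` holds:
for every `ρ > 0` there is `c > 0` with `c ≤ f_p(n,⌊ρn⌋) ≤ 1 - c` whenever `ρn ≥ 1`.  Lower bound: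
`f(n,h) ≥ f(2h,h) ≥ c₁` if `n ≤ 2h`; `f(n,h) ≥ f(rh,h) ≥ a_{r-2}` with `r = ⌊n/h⌋+1 ≤ ⌈2/ρ⌉+2`
(`real_lr_long_ge`) if `h ≥ 4ρ₀+9`; `f(n,h) ≥ p^n` for the finitely many remaining `n`
(`pow_le_real_lr`).  Upper bound: `f(n,h) ≤ f(n,(2^J+1)n) ≤ 1 - c₂^{3^J}`, `J = ⌈ρ⌉`
(`real_lr_tall_le`). [cite: NewmanTassionWu2017, §3.7 (proof of Theorem 3.1: "(3.59) and (3.60) together with Items 1 and 2 of Proposition 3.9 conclude the proof")] -/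
theorem boxCrossingProperty_of_rsw (hk : 1 ≤ k) {ρ₀ : ℕ} (hρ₀ : 4 ≤ ρ₀) (p : unitInterval)
    (hp0 : 0 < (p : ℝ)) (hp1 : (p : ℝ) < 1)
    (hlow : ∃ c₁ : ℝ, 0 < c₁ ∧ ∀ n : ℕ, 1 ≤ n → c₁ ≤ (bondPercolation (slabGraph 3 k) p).real
      (slabConn k (boxR 0 (2 * n) 0 n) {z | z.1 = 0} {z | z.1 = 2 * n}))
    (hup : ∃ c₂ : ℝ, 0 < c₂ ∧ ∀ n : ℕ, 1 ≤ n → (bondPercolation (slabGraph 3 k) p).real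
      (slabConn k (boxR 0 n 0 (2 * n)) {z | z.1 = 0} {z | z.1 = n}) ≤ 1 - c₂) :
    BoxCrossingProperty k p := by
  set P := bondPercolation (slabGraph 3 k) p with hP
  obtain ⟨c₁, hc₁, hlow⟩ := hlow
  obtain ⟨c₂, hc₂, hup⟩ := hup
  have hc₁1 : c₁ ≤ 1 := (hlow 1 le_rfl).trans measureReal_le_one
  obtain ⟨a, ha0, ha1, hanti, hlong⟩ := real_lr_long_ge hk hρ₀ p hp0 hp1 hc₁ hc₁1 hlow
  have hanti' : Antitone a := antitone_nat_of_succ_le hanti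
  intro ρ hρ
  -- the constants
  set N₁ : ℕ := 4 * ρ₀ + 9 with hN₁
  set R : ℕ := ⌈2 / ρ⌉₊ with hR
  set M : ℕ := ⌈(N₁ : ℝ) / ρ⌉₊ with hM
  set J : ℕ := ⌈ρ⌉₊ with hJ
  have hJρ : ρ ≤ J := Nat.le_ceil ρ
  have hJ2 : (J : ℝ) ≤ (2 : ℝ) ^ J := by exact_mod_cast (Nat.lt_two_pow_self (n := J)).le
  set c : ℝ := min (min (min c₁ (a R)) ((p : ℝ) ^ M)) (c₂ ^ 3 ^ J) with hc
  have hcpos : 0 < c := lt_min (lt_min (lt_min hc₁ (ha0 R)) (by positivity)) (by positivity)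
  refine ⟨c, hcpos, fun n hn => ?_⟩
  rw [crossingProb_eq]
  set h : ℕ := ⌊ρ * (n : ℝ)⌋₊ with hh
  have hρn0 : 0 ≤ ρ * n := by positivity
  have hn1 : 1 ≤ n := by
    by_contra h0
    push Not at h0
    have : n = 0 := by omega
    rw [this] at hn; simp at hn; linarith
  have hh1 : 1 ≤ h := by rw [hh]; exact Nat.le_floor (by exact_mod_cast hn)
  have hhle : (h : ℝ) ≤ ρ * n := Nat.floor_le hρn0
  have hhlt : ρ * n < h + 1 := Nat.lt_floor_add_one _
  constructor
  · ---------------------------------------------------------------- lower bound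
    by_cases hsmall : h < N₁
    · -- finitely many `n`: the straight path
      have hnM : n ≤ M := by
        have h1 : ρ * n < N₁ := by
          have : (h : ℝ) + 1 ≤ N₁ := by exact_mod_cast hsmall
          linarith
        have h2 : (n : ℝ) < N₁ / ρ := by rw [lt_div_iff₀ hρ]; linarith
        have h3 : (n : ℝ) ≤ M := h2.le.trans (Nat.le_ceil _)
        exact_mod_cast h3
      calc c ≤ (p : ℝ) ^ M := (min_le_left _ _).trans (min_le_right _ _)
        _ ≤ (p : ℝ) ^ n := pow_le_pow_of_le_one p.2.1 p.2.2 hnM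
        _ ≤ _ := pow_le_real_lr n h p
    · push Not at hsmall
      by_cases hA : n ≤ 2 * h
      · -- `f(n,h) ≥ f(2h,h) ≥ c₁`
        calc c ≤ c₁ := (min_le_left _ _).trans ((min_le_left _ _).trans (min_le_left _ _))
          _ ≤ P.real (slabConn k (boxR 0 (2 * h) 0 h) {z : ℤ × ℤ | z.1 = 0} {z | z.1 = 2 * h}) := hlow h hh1
          _ ≤ _ := real_lr_wider_le (k := k) (a := 0) (b := n) (b' := 2 * h) (c := 0) (d := h)
              (by positivity) (by exact_mod_cast hA) p
      · -- `f(n,h) ≥ f(rh,h) ≥ a_{r-2} ≥ a_R`, `r = n/h + 1`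
        push Not at hA
        set q : ℕ := n / h with hq
        have hh0 : 0 < h := by omega
        have hnq : n < (q + 1) * h := by
          have := Nat.lt_div_mul_add (a := n) hh0
          rw [hq]; linarith
        have hq2 : 2 ≤ q := by
          rw [hq, Nat.le_div_iff_mul_le hh0]; omega
        have hqR : q - 1 ≤ R := by
          -- `q ≤ n/h ≤ 2/ρ`
          have hqle : (q : ℝ) ≤ (n : ℝ) / h := by rw [hq]; exact Nat.cast_div_le
          have hnh : (n : ℝ) / h ≤ 2 / ρ := by
            rw [div_le_div_iff₀ (by exact_mod_cast hh0) hρ]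
            by_cases h2 : 2 ≤ ρ * n
            · nlinarith
            · push Not at h2
              have : (1 : ℝ) ≤ h := by exact_mod_cast hh1
              nlinarith
          have : (q : ℝ) ≤ R := (hqle.trans hnh).trans (Nat.le_ceil _)
          have : q ≤ R := by exact_mod_cast this
          omega
        calc c ≤ a R := (min_le_left _ _).trans ((min_le_left _ _).trans (min_le_right _ _))
          _ ≤ a (q - 1) := hanti' hqR
          _ ≤ P.real (slabConn k (boxR 0 ((((q - 1 : ℕ) : ℤ) + 2) * h) 0 h) {z : ℤ × ℤ | z.1 = 0}
              {z | z.1 = (((q - 1 : ℕ) : ℤ) + 2) * h}) := hlong (q - 1) h hsmall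
          _ ≤ _ := by
              have e : ((q - 1 : ℕ) : ℤ) + 2 = ((q + 1 : ℕ) : ℤ) := by push_cast [Nat.cast_sub (by omega : 1 ≤ q)]; ring
              rw [e]
              refine real_lr_wider_le (k := k) (a := 0) (b := n) (c := 0) (d := h) (by positivity) ?_ p
              have : (n : ℤ) < ((q + 1 : ℕ) : ℤ) * h := by exact_mod_cast hnq
              exact this.le
  · ---------------------------------------------------------------- upper bound
    have htall : (h : ℤ) ≤ (2 ^ J + 1) * n := by
      have h1 : (h : ℝ) ≤ (2 ^ J + 1) * n := by
        have hn0 : (0 : ℝ) ≤ n := by positivity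
        nlinarith
      exact_mod_cast h1
    calc P.real (slabConn k (boxR 0 n 0 h) {z : ℤ × ℤ | z.1 = 0} {z | z.1 = n})
        ≤ P.real (slabConn k (boxR 0 n 0 ((2 ^ J + 1) * n)) {z : ℤ × ℤ | z.1 = 0} {z | z.1 = n}) :=
          real_lr_le_taller (k := k) (a := 0) (b := n) (c := 0) (d := h) (c' := 0) (d' := (2 ^ J + 1) * n)
            le_rfl htall p
      _ ≤ 1 - c₂ ^ 3 ^ J := real_lr_tall_le hc₂.le p (hup n hn1) J
      _ ≤ 1 - c := by linarith [min_le_right (min (min c₁ (a R)) ((p : ℝ) ^ M)) (c₂ ^ 3 ^ J)]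

end NTW17

end Literature.Probability.Percolation
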